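import Summits.QuantumFields.YangMills.Theorems.UnitScaleTiltProp7TwistedTowerFramesT3
import Summits.QuantumFields.YangMills.Theorems.UnitScaleTiltProp7TwistedLevelMassInduction
import Summits.QuantumFields.YangMills.Theorems.UnitScaleTiltProp7CompetitorGuardOfLevelSups
import HarnessLib


/-!
# Route `UnitScaleTilt`, crux K1 «MinimiserStabilityRegPr» (stmt-QuantumFields-19200), route-R E′ (A′) «HCOW-VIA-Σ», row P-A2 «JOINT-Σ», file F3″-C3 —
# THE T³ KNIT OF THE TWISTED LEVEL MASSES (d = 3, `SU(2)`): for every `l ≤ K − n`,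
# `Σ_b ‖V^{(l)}(b)·Ū₀^{(l)}(b)⁻¹ − 1‖² ≤ (21 + 10080L³)·M₀·L^{−l} + (3 + 720L²)·(28800L⁴·(CURL + DIV) + 600000L⁴·ℓ⁻²·M₀)·Lˡ`
# under (n3)'s binders, the guards, and NO displayed frame window (the accumulated frames are within `2ρ_l` of `1` in sup at every level, by induction)

Cell `ym3-torus`, width seat `ym3-torus-px17` (gen 3); px22 g3 ■ FINAL «F3″-C is the one pen left»; LOCATE `LOCATE-PA2-F3C-T3KNIT-px17g3.md` (19200 evidence #50).  THE POINT.  The covariant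
double-bar tower `V^{(l)} = dbarCovIterU l U₀♭ W♭` (`♭ = unitsField ∘ toUField`) of the competitor against the background tower `Ū₀^{(l)} = emlIterU l U₀♭` is, by (97), the plain tower in the
accumulated frames `v_l = frameAccU l U₀♭ W♭`; F3″-C1 (✓ `Prop7TwistedLinkFrameSup`) reduces its level mass to `3·(M^{sb}_l + 2d·Φ_l)` (single-bar mass + frame mass), F3″-B2c (✓ `Prop7FrameMassStep`)
gives the `Φ`-recursion, F3″-A (✓ `Prop7TwistedLevelMassInduction`) the bookkeeping and (n3) (✓ `Prop7FibreLevelMassPerLevelT3.sum_normSq_levelRatio_le_LOnly_T3`) the single-bar masses.  This file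
is the T³ knit's second half (first half = F3″-C2 ✓ `Prop7TwistedTowerFramesT3`: dictionary, stair row `C_R = 3L`, joint level induction «frames ∈ SU(2) ∧ sup ≤ 2ρ_l», `ρ_l := θLˡ∕(7800L³L^{K−n})`):
§4 the `Φ`-recursion with FIXED L-only constants `q = 4(L³)⁻¹ + (18L)⁻¹` (`qL ≤ ½`), `C = 40L²` (✓ `frameMass_step_le` ∘ F3″-C2, ✓ `recursion_numerals`), §5 the title in both readings — guards displayed
(`…_of_guards`) and, through px22 g4's ✓ `Prop7CompetitorGuardOfLevelSups` (when imported by the consumer), under (n3)'s binders alone — plus the sup letter of the twisted link and the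
`‖· − 1‖ → log` currency exchange (lit ✓ `MatrixLog.norm_mlog_le_two_mul`).  THEOREMS ONLY (0 `def`, 0 `sorry`); `--supports stmt-QuantumFields-19200`, count-neutral.
YM₃ on T³ is a ladder rung (R3), not the Clay problem; nothing here claims the stub, the crux, d = 4 or the gap.

References: T. Bałaban, CMP 98 (1985) 17–51 [Balaban1985Averaging] ((58) p.27, (82) p.30, (89) p.31, (97) p.32, Prop. 3 (122)–(126) p.36); CMP 109 (1987) 249–301 [Balaban1987RG1] ((0.3)–(0.4),
(0.9)–(0.11) pp.252–253); CMP 95 (1984) 17–40 [Balaban1984PropagatorsI] ((1.18)–(1.20) pp.19–20); CMP 102 (1985) 277–309 [Balaban1985Variational] ((14)–(15) p.280, (146) p.301, Prop. 7 p.299).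
-/

set_option autoImplicit false

noncomputable section

open scoped BigOperators Matrix.Norms.L2Operator

namespace Summit.QuantumFields.YangMills.Theorems.Prop7TwistedLevelMassT3

open Finset
open Literature.MathematicalPhysics.QuantumFieldTheory.Balaban1983to89
open Literature.MathematicalPhysics.QuantumFieldTheory.Balaban1983to89.T3ContinuumYM3Torus
open T4Continuum T4ReflectionCone BlockAveraging AveragingRT ExpMeanLog BlockAveragingEMLLinearisedBackground
open B10Eq27TorusAxialLog (holT transl unitsField toUField)
open B7Prop1Explicit (disp)
open T3RegularMinimiser (regThreshold)
open B9Eq39Adjoint (curl divB)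
open B9TorusCalculus (torusT)
open Summit.QuantumFields.YangMills.Theorems.Prop8Chart (emlIterU coe_emlIterU_unitsField coe_unitsField_toUField)
open Summit.QuantumFields.YangMills.Theorems.Prop8ChartAllL (small_iter_T3_allL)
open Summit.QuantumFields.YangMills.Theorems.Prop7SymAvgTwSym (tstairU vframeCovU coe_vframeCovU frameAccU frameAccU_zero frameAccU_succ dbarCovIterU)
open Summit.QuantumFields.YangMills.Theorems.Prop7AccumulatedFrameStep (tstairU_eq_frame_inv_mul)
open Summit.QuantumFields.YangMills.Theorems.Prop7FrameMassStep (norm_conj_sub_one_le norm_conj_le_one frameMass_step_le)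
open Summit.QuantumFields.YangMills.Theorems.Prop7TwistedLinkFrameSup (sum_normSq_twistedLink_le norm_tstairU_sub_one_le_sup norm_frameAccU_succ_sub_one_le_sup supStep_le)
open Summit.QuantumFields.YangMills.Theorems.Prop7TwistedLevelMassInduction (twistedMass_le_LOnly)
open Summit.QuantumFields.YangMills.Theorems.Prop7HolRatioWalkSum (norm_holRatio_sub_one_le_walkSum)
open Summit.QuantumFields.YangMills.Theorems.Prop7CovCombMeanFrames (coe_holT_su coe_inv_holT_su)
open Summit.QuantumFields.YangMills.Theorems.Prop7SymFrameBound (su2_pred_closure)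

open Summit.QuantumFields.YangMills.Theorems.Prop7TwistedTowerFramesT3 (emlIterU_eq_unitsField_iter coe_unitsField_mem_su2
  coe_holT_unitsField_mem_su2 coe_unitsField_mul_inv_sub_one coe_holT_mul_inv_eq stair_row_of_twoBlockSup rho_facts mu_le_rho frameAccU_su2_and_sup)
open Summit.QuantumFields.YangMills.Theorems.Prop7FrameCorrectedMinusMean (norm_le_one_of_mem_specialUnitaryGroup)
open Summit.QuantumFields.YangMills.Theorems.Prop7CompetitorGuardOfLevelSups (small_iter_competitor_T3 small_iter_background_T3')

section T3

variable (F : T3Family) (n K : ℕ)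

/-! ## §4 The `Φ`-recursion with fixed L-only constants -/

/-- the numerals of the fixed recursion constants: for `0 ≤ ρ ≤ 10⁻⁶` with `ρ·L ≤ 10⁻⁶` (`L > 0`),
`4·((L³)⁻¹ + 180·(ρ + 3·(2ρ))²) ≤ 4·(L³)⁻¹ + (18L)⁻¹` and `4·(1 + 6·(ρ + 3·(2ρ)))²·(3L)² ≤ 40·L²`. [folklore] -/
theorem recursion_numerals {L ρ : ℝ} (hL0 : 0 < L) (hρ0 : 0 ≤ ρ) (hρ6 : ρ ≤ 1 / 10 ^ 6) (hρL6 : ρ * L ≤ 1 / 10 ^ 6) :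
    4 * ((L ^ 3)⁻¹ + 180 * (ρ + 3 * (2 * ρ)) ^ 2) ≤ 4 * (L ^ 3)⁻¹ + (18 * L)⁻¹ ∧
      4 * (1 + 6 * (ρ + 3 * (2 * ρ))) ^ 2 * (3 * L) ^ 2 ≤ 40 * L ^ 2 := by
  constructor
  · have h18 : 0 < 18 * L := by positivity
    have hρρL : ρ * (ρ * L) ≤ 1 / 10 ^ 6 * (1 / 10 ^ 6) := mul_le_mul hρ6 hρL6 (by positivity) (by positivity)
    have key : 720 * (7 * ρ) ^ 2 ≤ (18 * L)⁻¹ := by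
      rw [inv_eq_one_div, le_div_iff₀ h18]
      nlinarith
    nlinarith [key]
  · have h1 : (1 + 6 * (ρ + 3 * (2 * ρ))) ^ 2 ≤ 10 / 9 := by nlinarith
    nlinarith [sq_nonneg L]

/-- ★★ **THE `Φ`-RECURSION AT T³ WITH FIXED L-ONLY CONSTANTS**: under the guards and (n3)'s two-block sup rows, for every `l < K − n`,
`Φ_{l+1} ≤ (4(L³)⁻¹ + (18L)⁻¹)·Φ_l + 40L²·M^{sb}_l` with `Φ_l = Σ_x ‖v_l(x) − 1‖²`, `M^{sb}_l = Σ_b ‖Y_l(b)‖²` (✓ `frameMass_step_le` fed by §2–§3 at `δ₂ = 2ρ_l`, `ρ = ρ_l`, `C_R = 3L`,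
`Σ_y B(y) = M^{sb}_l` fibrewise, then ✓ `recursion_numerals`) — the `hΦ` of ✓ `frameMass_induction` with `q·L ≤ 4∕9 + 1∕18 = ½`. [cite: Balaban1985Averaging, (82) p.30, (97) p.32, Prop. 3 (122)-(126) p.36] -/
theorem frameMass_recursion_T3 (U₀ W : GaugeField (F.P K) 0 (Matrix.specialUnitaryGroup (Fin 2) ℂ))
    (hU₀g : ∀ i, i < K - n → ∀ c : PBond (F.P K) (i + 1), Small (expMeanLogSU (n := Fin 2)) (Averaging.iter (fun j => blockAvg (P := F.P K) (j := j) (expMeanLogSU (n := Fin 2))) i U₀) c)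
    (hWg : ∀ i, i < K - n → ∀ c : PBond (F.P K) (i + 1), Small (expMeanLogSU (n := Fin 2)) (Averaging.iter (fun j => blockAvg (P := F.P K) (j := j) (expMeanLogSU (n := Fin 2))) i W) c)
    (μ : ℕ → ℝ)
    (hμ : ∀ j < K - n, ∀ c : PBond (F.P K) (j + 1), ((((F.P K).d + 2) * (F.P K).L : ℕ) : ℝ) * ∑ b ∈ (univ.filter (fun b : PBond (F.P K) j => blockOf b.src = c.src ∨ blockOf b.src = c.tgt)), ‖(pertVar (Averaging.iter (fun i => blockAvg (P := (F.P K)) (j := i) (expMeanLogSU (n := Fin 2))) j U₀) (Averaging.iter (fun i => blockAvg (P := (F.P K)) (j := i) (expMeanLogSU (n := Fin 2))) j W)) b‖ ≤ μ j)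
    (hμ72 : ∀ j < K - n, 72 * μ j ≤ 1)
    {θ : ℝ} (hθ0 : 0 ≤ θ) (hμθ : ∀ j < K - n, 7800 * (F.L : ℝ) ^ 3 * (F.L : ℝ) ^ (K - n) * μ j ≤ θ * (F.L : ℝ) ^ j)
    (hθL : 1000 * θ * (F.L : ℝ) ≤ 1) :
    ∀ l, l < K - n →
      ∑ y : Site (F.P K) (l + 1), ‖((frameAccU (l + 1) (unitsField (toUField U₀)) (unitsField (toUField W)) y : (Matrix (Fin 2) (Fin 2) ℂ)ˣ) : Matrix (Fin 2) (Fin 2) ℂ) - 1‖ ^ 2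
        ≤ (4 * ((F.L : ℝ) ^ 3)⁻¹ + (18 * (F.L : ℝ))⁻¹) * ∑ x : Site (F.P K) l, ‖((frameAccU l (unitsField (toUField U₀)) (unitsField (toUField W)) x : (Matrix (Fin 2) (Fin 2) ℂ)ˣ) : Matrix (Fin 2) (Fin 2) ℂ) - 1‖ ^ 2
          + 40 * (F.L : ℝ) ^ 2 * ∑ b : PBond (F.P K) l, ‖(pertVar (Averaging.iter (fun i => blockAvg (P := (F.P K)) (j := i) (expMeanLogSU (n := Fin 2))) l U₀) (Averaging.iter (fun i => blockAvg (P := (F.P K)) (j := i) (expMeanLogSU (n := Fin 2))) l W)) b‖ ^ 2 := by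
  have hL3 : (3 : ℝ) ≤ F.L := Prop7CurvedLandauKnitT3.three_le_L F
  have hL0 : (0 : ℝ) < F.L := by linarith
  have hd : (F.P K).d = 3 := T3Family.P_d F K
  have hLL : ((F.P K).L : ℝ) = F.L := rfl
  intro l hl'
  have hlK : l + 1 ≤ (F.P K).m + (F.P K).K := by show l + 1 ≤ F.m + K; have := F.hm; omega
  obtain ⟨hsu, hsup⟩ := frameAccU_su2_and_sup F n K U₀ W hU₀g hWg μ hμ hμ72 hθ0 hμθ hθL l hl'.le
  obtain ⟨hρ0, -, hρ6, hρL6⟩ := rho_facts hL3 hθ0 hθL (K - n) l hl'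
  have hUeq := emlIterU_eq_unitsField_iter U₀ (K - n) hU₀g hl'.le
  have hWeq := emlIterU_eq_unitsField_iter W (K - n) hWg hl'.le
  have hv1 : ∀ x : Site (F.P K) l, ‖((frameAccU l (unitsField (toUField U₀)) (unitsField (toUField W)) x : (Matrix (Fin 2) (Fin 2) ℂ)ˣ) : Matrix (Fin 2) (Fin 2) ℂ)‖ ≤ 1 :=
    fun x => (norm_le_one_of_mem_specialUnitaryGroup (hsu x)).1
  have hv1' : ∀ x : Site (F.P K) l, ‖(((frameAccU l (unitsField (toUField U₀)) (unitsField (toUField W)) x)⁻¹ : (Matrix (Fin 2) (Fin 2) ℂ)ˣ) : Matrix (Fin 2) (Fin 2) ℂ)‖ ≤ 1 :=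
    fun x => (norm_le_one_of_mem_specialUnitaryGroup (hsu x)).2
  have hν : ∀ (y : Site (F.P K) (l + 1)) (i : Idx (F.P K)),
      ‖((holT (emlIterU l (unitsField (toUField U₀))) (emb y) (stairWord i.2.1 (off i.1)) : (Matrix (Fin 2) (Fin 2) ℂ)ˣ) : Matrix (Fin 2) (Fin 2) ℂ)‖ ≤ 1 ∧
      ‖(((holT (emlIterU l (unitsField (toUField U₀))) (emb y) (stairWord i.2.1 (off i.1)))⁻¹ : (Matrix (Fin 2) (Fin 2) ℂ)ˣ) : Matrix (Fin 2) (Fin 2) ℂ)‖ ≤ 1 := by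
    intro y i
    have hsuT : ((holT (emlIterU l (unitsField (toUField U₀))) (emb y) (stairWord i.2.1 (off i.1)) : (Matrix (Fin 2) (Fin 2) ℂ)ˣ) : Matrix (Fin 2) (Fin 2) ℂ) ∈ Matrix.specialUnitaryGroup (Fin 2) ℂ := by
      rw [hUeq]; exact coe_holT_unitsField_mem_su2 _ _ _
    exact norm_le_one_of_mem_specialUnitaryGroup hsuT
  obtain ⟨hstair, hstairμ⟩ := stair_row_of_twoBlockSup hd hlK
    (Averaging.iter (fun i => blockAvg (P := (F.P K)) (j := i) (expMeanLogSU (n := Fin 2))) l U₀)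
    (Averaging.iter (fun i => blockAvg (P := (F.P K)) (j := i) (expMeanLogSU (n := Fin 2))) l W) (hμ l hl') (hμ72 l hl')
  have hμρ : μ l ≤ θ * (F.L : ℝ) ^ l / (7800 * (F.L : ℝ) ^ 3 * (F.L : ℝ) ^ (K - n)) := mu_le_rho hL0 (K - n) l (hμθ l hl')
  have hR : ∀ (y : Site (F.P K) (l + 1)) (i : Idx (F.P K)),
      ‖((holT (emlIterU l (unitsField (toUField W))) (emb y) (stairWord i.2.1 (off i.1)) * (holT (emlIterU l (unitsField (toUField U₀))) (emb y) (stairWord i.2.1 (off i.1)))⁻¹ :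
          (Matrix (Fin 2) (Fin 2) ℂ)ˣ) : Matrix (Fin 2) (Fin 2) ℂ) - 1‖
        ≤ 3 * (F.L : ℝ) * Real.sqrt (∑ b ∈ univ.filter (fun b : PBond (F.P K) l => blockOf b.src = y),
            ‖pertVar (Averaging.iter (fun i => blockAvg (P := (F.P K)) (j := i) (expMeanLogSU (n := Fin 2))) l U₀) (Averaging.iter (fun i => blockAvg (P := (F.P K)) (j := i) (expMeanLogSU (n := Fin 2))) l W) b‖ ^ 2) := by
    intro y i
    rw [hUeq, hWeq, coe_holT_mul_inv_eq]
    exact hstair y i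
  have hρB : ∀ y : Site (F.P K) (l + 1), 3 * (F.L : ℝ) * Real.sqrt (∑ b ∈ univ.filter (fun b : PBond (F.P K) l => blockOf b.src = y),
            ‖pertVar (Averaging.iter (fun i => blockAvg (P := (F.P K)) (j := i) (expMeanLogSU (n := Fin 2))) l U₀) (Averaging.iter (fun i => blockAvg (P := (F.P K)) (j := i) (expMeanLogSU (n := Fin 2))) l W) b‖ ^ 2)
        ≤ θ * (F.L : ℝ) ^ l / (7800 * (F.L : ℝ) ^ 3 * (F.L : ℝ) ^ (K - n)) := fun y => (hstairμ y).trans hμρ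
  obtain ⟨-, hwin⟩ := supStep_le _ _ _ hρ0 (by linarith) (by positivity) le_rfl (le_refl (2 * (θ * (F.L : ℝ) ^ l / (7800 * (F.L : ℝ) ^ 3 * (F.L : ℝ) ^ (K - n)))))
  have hstep := frameMass_step_le hlK (unitsField (toUField U₀)) (unitsField (toUField W))
    (fun y => ∑ b ∈ univ.filter (fun b : PBond (F.P K) l => blockOf b.src = y),
      ‖pertVar (Averaging.iter (fun i => blockAvg (P := (F.P K)) (j := i) (expMeanLogSU (n := Fin 2))) l U₀) (Averaging.iter (fun i => blockAvg (P := (F.P K)) (j := i) (expMeanLogSU (n := Fin 2))) l W) b‖ ^ 2)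
    (by positivity : (0 : ℝ) ≤ 3 * (F.L : ℝ)) (fun y => Finset.sum_nonneg fun _ _ => sq_nonneg _) (by positivity) hρ0 hv1 hv1' hν hsup hR hρB hwin
  -- `Σ_y B(y) = M^{sb}_l` and the numerals
  rw [Finset.sum_fiberwise (s := univ) (g := fun b : PBond (F.P K) l => blockOf b.src), hd, hLL] at hstep
  obtain ⟨hq, hC⟩ := recursion_numerals hL0 hρ0 hρ6 hρL6
  have hΦ0 : 0 ≤ ∑ x : Site (F.P K) l, ‖((frameAccU l (unitsField (toUField U₀)) (unitsField (toUField W)) x : (Matrix (Fin 2) (Fin 2) ℂ)ˣ) : Matrix (Fin 2) (Fin 2) ℂ) - 1‖ ^ 2 :=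
    Finset.sum_nonneg fun _ _ => sq_nonneg _
  have hM0 : 0 ≤ ∑ b : PBond (F.P K) l, ‖(pertVar (Averaging.iter (fun i => blockAvg (P := (F.P K)) (j := i) (expMeanLogSU (n := Fin 2))) l U₀) (Averaging.iter (fun i => blockAvg (P := (F.P K)) (j := i) (expMeanLogSU (n := Fin 2))) l W)) b‖ ^ 2 :=
    Finset.sum_nonneg fun _ _ => sq_nonneg _
  have h1 := mul_le_mul_of_nonneg_right hq hΦ0
  have h2 := mul_le_mul_of_nonneg_right hC hM0
  linarith

/-! ## §5 The title: the twisted level masses at T³ -/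

/-- ★★★ **THE TWISTED LEVEL MASSES AT T³, GUARDS DISPLAYED** (d = 3, `SU(2)`): under (n3) ✓ `sum_normSq_levelRatio_le_LOnly_T3`'s binders VERBATIM plus the (0.4) guards of both towers
(`hU₀g`, `hWg` — the `hsmall` shape of ✓ `Prop8Chart.coe_emlIterU_unitsField`), for every `l ≤ K − n`:
`Σ_b ‖V^{(l)}(b)·Ū₀^{(l)}(b)⁻¹ − 1‖² ≤ (21 + 10080L³)·M₀·(Lˡ)⁻¹ + (3 + 720L²)·(28800L⁴·(CURL + DIV) + 600000L⁴·ℓ⁻²·M₀)·Lˡ`, `M₀ = Σ‖pertVar U₀ W‖²`, `ℓ = L^{K−n}` — the `hM` shape of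
✓ `Prop7JointRowOfLevelMasses.jointRow_currency` for the TWISTED tower (✓ `twistedMass_le_LOnly` at `C = 40L²` ∘ §4 ∘ F3″-C1 §1 ∘ (n3)); NO frame window displayed (§3).
[cite: Balaban1985Averaging, (89) p.31, (97) p.32, Prop. 3 (122)-(126) p.36; Balaban1984PropagatorsI, (1.18)-(1.20) pp.19-20; Balaban1985Variational, (14)-(15) p.280, Prop. 7 p.299] -/
theorem sum_normSq_twistedLevelRatio_le_LOnly_T3_of_guards (U₀ W : GaugeField (F.P K) 0 (Matrix.specialUnitaryGroup (Fin 2) ℂ)) {ε : ℝ} (hε : 0 < ε) (hεL : 1000000 * (F.L : ℝ) ^ 5 * ε ≤ 1)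
    (hU : ∀ p : Plaq (F.P K) 0, dist1 (GaugeField.plaqHol U₀ p) ≤ ε * (((F.L : ℝ) ^ (K - n)) ^ 2)⁻¹)
    (hU₀g : ∀ i, i < K - n → ∀ c : PBond (F.P K) (i + 1), Small (expMeanLogSU (n := Fin 2)) (Averaging.iter (fun j => blockAvg (P := F.P K) (j := j) (expMeanLogSU (n := Fin 2))) i U₀) c)
    (hWg : ∀ i, i < K - n → ∀ c : PBond (F.P K) (i + 1), Small (expMeanLogSU (n := Fin 2)) (Averaging.iter (fun j => blockAvg (P := F.P K) (j := j) (expMeanLogSU (n := Fin 2))) i W) c)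
    (μ : ℕ → ℝ) (hμ0 : ∀ j < K - n, 0 ≤ μ j)
    (hμ : ∀ j < K - n, ∀ c : PBond (F.P K) (j + 1), ((((F.P K).d + 2) * (F.P K).L : ℕ) : ℝ) * ∑ b ∈ (univ.filter (fun b : PBond (F.P K) j => blockOf b.src = c.src ∨ blockOf b.src = c.tgt)), ‖(pertVar (Averaging.iter (fun i => blockAvg (P := (F.P K)) (j := i) (expMeanLogSU (n := Fin 2))) j U₀) (Averaging.iter (fun i => blockAvg (P := (F.P K)) (j := i) (expMeanLogSU (n := Fin 2))) j W)) b‖ ≤ μ j)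
    (hμ72 : ∀ j < K - n, 72 * μ j ≤ 1) (hμN : ∀ j < K - n, 3 * μ j + 1 / 24 < deltaSU (Fin 2))
    {θ : ℝ} (hθ0 : 0 ≤ θ) (hμθ : ∀ j < K - n, 7800 * (F.L : ℝ) ^ 3 * (F.L : ℝ) ^ (K - n) * μ j ≤ θ * (F.L : ℝ) ^ j)
    (hθL : 1000 * θ * (F.L : ℝ) ≤ 1) :
    ∀ l ≤ K - n, ∑ b : PBond (F.P K) l, ‖((dbarCovIterU l (unitsField (toUField U₀)) (unitsField (toUField W)) b * (emlIterU l (unitsField (toUField U₀)) b)⁻¹ : (Matrix (Fin 2) (Fin 2) ℂ)ˣ) : Matrix (Fin 2) (Fin 2) ℂ) - 1‖ ^ 2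
      ≤ (21 + 10080 * (F.L : ℝ) ^ 3) * ((∑ b : PBond (F.P K) 0, ‖pertVar U₀ W b‖ ^ 2) * ((F.L : ℝ) ^ l)⁻¹)
        + (3 + 720 * (F.L : ℝ) ^ 2) * ((28800 * (F.L : ℝ) ^ 4 * ((∑ x : Site (F.P K) 0, ∑ μ : Fin (F.P K).d, ∑ ν : Fin (F.P K).d,
            (if μ < ν then ∑ j : Fin 2, ∑ k : Fin 2,
              ‖(curl (torusT (F.P K) 0) (fun κ z => unitsField (toUField U₀) ⟨z, κ⟩) (fun κ z => pertVar U₀ W ⟨z, κ⟩) μ ν x) j k‖ ^ 2 else 0)) + (∑ x : Site (F.P K) 0, ∑ j : Fin 2, ∑ k : Fin 2,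
            ‖(divB (torusT (F.P K) 0) (fun κ z => unitsField (toUField U₀) ⟨z, κ⟩) (fun κ z => pertVar U₀ W ⟨z, κ⟩) x) j k‖ ^ 2))
            + 600000 * (F.L : ℝ) ^ 4 * (((F.L : ℝ) ^ (K - n)) ^ 2)⁻¹ * (∑ b : PBond (F.P K) 0, ‖pertVar U₀ W b‖ ^ 2)) * (F.L : ℝ) ^ l) := by
  have hL3 : (3 : ℝ) ≤ F.L := Prop7CurvedLandauKnitT3.three_le_L F
  have hL0 : (0 : ℝ) < F.L := by linarith
  have hd3 : (((F.P K).d : ℕ) : ℝ) = 3 := by rw [T3Family.P_d]; norm_num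
  -- (n3): the single-bar level masses
  have hM := Prop7FibreLevelMassPerLevelT3.sum_normSq_levelRatio_le_LOnly_T3 F n K U₀ W hε hεL hU μ hμ0 hμ hμ72 hμN hθ0 hμθ hθL
  -- §4: the `Φ`-recursion; F3″-C1 §1 + §3: the twisted link row
  have hΦ := frameMass_recursion_T3 F n K U₀ W hU₀g hWg μ hμ hμ72 hθ0 hμθ hθL
  have hMtw : ∀ l ≤ K - n, ∑ b : PBond (F.P K) l, ‖((dbarCovIterU l (unitsField (toUField U₀)) (unitsField (toUField W)) b * (emlIterU l (unitsField (toUField U₀)) b)⁻¹ : (Matrix (Fin 2) (Fin 2) ℂ)ˣ) : Matrix (Fin 2) (Fin 2) ℂ) - 1‖ ^ 2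
      ≤ 3 * (∑ b : PBond (F.P K) l, ‖(pertVar (Averaging.iter (fun i => blockAvg (P := (F.P K)) (j := i) (expMeanLogSU (n := Fin 2))) l U₀) (Averaging.iter (fun i => blockAvg (P := (F.P K)) (j := i) (expMeanLogSU (n := Fin 2))) l W)) b‖ ^ 2
        + 2 * 3 * ∑ x : Site (F.P K) l, ‖((frameAccU l (unitsField (toUField U₀)) (unitsField (toUField W)) x : (Matrix (Fin 2) (Fin 2) ℂ)ˣ) : Matrix (Fin 2) (Fin 2) ℂ) - 1‖ ^ 2) := by
    intro l hl
    obtain ⟨hsu, -⟩ := frameAccU_su2_and_sup F n K U₀ W hU₀g hWg μ hμ hμ72 hθ0 hμθ hθL l hl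
    have hUeq := emlIterU_eq_unitsField_iter U₀ (K - n) hU₀g hl
    have hWeq := emlIterU_eq_unitsField_iter W (K - n) hWg hl
    have h := sum_normSq_twistedLink_le l (unitsField (toUField U₀)) (unitsField (toUField W))
      (fun x => (norm_le_one_of_mem_specialUnitaryGroup (hsu x)).1) (fun x => (norm_le_one_of_mem_specialUnitaryGroup (hsu x)).2)
      (fun b => by rw [hWeq]; exact (norm_le_one_of_mem_specialUnitaryGroup (coe_unitsField_mem_su2 _ b)).1)
      (fun b => by rw [hUeq]; exact (norm_le_one_of_mem_specialUnitaryGroup (coe_unitsField_mem_su2 _ b)).1)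
      (fun b => by rw [hUeq]; exact (norm_le_one_of_mem_specialUnitaryGroup (coe_unitsField_mem_su2 _ b)).2)
    have hsb : ∑ b : PBond (F.P K) l, ‖((emlIterU l (unitsField (toUField W)) b * (emlIterU l (unitsField (toUField U₀)) b)⁻¹ : (Matrix (Fin 2) (Fin 2) ℂ)ˣ) : Matrix (Fin 2) (Fin 2) ℂ) - 1‖ ^ 2
        = ∑ b : PBond (F.P K) l, ‖(pertVar (Averaging.iter (fun i => blockAvg (P := (F.P K)) (j := i) (expMeanLogSU (n := Fin 2))) l U₀) (Averaging.iter (fun i => blockAvg (P := (F.P K)) (j := i) (expMeanLogSU (n := Fin 2))) l W)) b‖ ^ 2 := by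
      refine Finset.sum_congr rfl fun b _ => ?_
      rw [hUeq, hWeq, coe_unitsField_mul_inv_sub_one]
    rw [hsb, hd3] at h
    exact h
  -- F3″-A: the induction
  intro l hl
  have hq : (0 : ℝ) ≤ 4 * ((F.L : ℝ) ^ 3)⁻¹ + (18 * (F.L : ℝ))⁻¹ := by positivity
  have hqL : (4 * ((F.L : ℝ) ^ 3)⁻¹ + (18 * (F.L : ℝ))⁻¹) * (F.L : ℝ) ≤ 1 / 2 := by
    have hA : ((F.L : ℝ) ^ 3)⁻¹ * (F.L : ℝ) ≤ 1 / 9 := by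
      rw [inv_mul_le_iff₀ (by positivity)]
      have hL9 : (9 : ℝ) ≤ (F.L : ℝ) ^ 2 := by nlinarith
      have e3 : (F.L : ℝ) ^ 3 = (F.L : ℝ) ^ 2 * (F.L : ℝ) := by ring
      rw [e3]
      nlinarith
    have hB : (18 * (F.L : ℝ))⁻¹ * (F.L : ℝ) = 1 / 18 := by
      rw [inv_mul_eq_div, div_eq_iff (by positivity)]; ring
    calc (4 * ((F.L : ℝ) ^ 3)⁻¹ + (18 * (F.L : ℝ))⁻¹) * (F.L : ℝ) = 4 * (((F.L : ℝ) ^ 3)⁻¹ * (F.L : ℝ)) + (18 * (F.L : ℝ))⁻¹ * (F.L : ℝ) := by ring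
      _ ≤ 4 * (1 / 9) + 1 / 18 := by rw [hB]; linarith
      _ = 1 / 2 := by norm_num
  have hM₀ : 0 ≤ ∑ b : PBond (F.P K) 0, ‖pertVar U₀ W b‖ ^ 2 := Finset.sum_nonneg fun _ _ => sq_nonneg _
  have hKD : 0 ≤ ((∑ x : Site (F.P K) 0, ∑ μ : Fin (F.P K).d, ∑ ν : Fin (F.P K).d,
            (if μ < ν then ∑ j : Fin 2, ∑ k : Fin 2,
              ‖(curl (torusT (F.P K) 0) (fun κ z => unitsField (toUField U₀) ⟨z, κ⟩) (fun κ z => pertVar U₀ W ⟨z, κ⟩) μ ν x) j k‖ ^ 2 else 0)) + (∑ x : Site (F.P K) 0, ∑ j : Fin 2, ∑ k : Fin 2,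
            ‖(divB (torusT (F.P K) 0) (fun κ z => unitsField (toUField U₀) ⟨z, κ⟩) (fun κ z => pertVar U₀ W ⟨z, κ⟩) x) j k‖ ^ 2)) := by positivity
  have hΦ0 : ∑ x : Site (F.P K) 0, ‖((frameAccU 0 (unitsField (toUField U₀)) (unitsField (toUField W)) x : (Matrix (Fin 2) (Fin 2) ℂ)ˣ) : Matrix (Fin 2) (Fin 2) ℂ) - 1‖ ^ 2 = 0 := by
    simp [frameAccU_zero]
  have h := twistedMass_le_LOnly (L := (F.L : ℝ)) (q := 4 * ((F.L : ℝ) ^ 3)⁻¹ + (18 * (F.L : ℝ))⁻¹) (C := 40 * (F.L : ℝ) ^ 2)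
    (M₀ := ∑ b : PBond (F.P K) 0, ‖pertVar U₀ W b‖ ^ 2) (KD := ((∑ x : Site (F.P K) 0, ∑ μ : Fin (F.P K).d, ∑ ν : Fin (F.P K).d,
            (if μ < ν then ∑ j : Fin 2, ∑ k : Fin 2,
              ‖(curl (torusT (F.P K) 0) (fun κ z => unitsField (toUField U₀) ⟨z, κ⟩) (fun κ z => pertVar U₀ W ⟨z, κ⟩) μ ν x) j k‖ ^ 2 else 0)) + (∑ x : Site (F.P K) 0, ∑ j : Fin 2, ∑ k : Fin 2,
            ‖(divB (torusT (F.P K) 0) (fun κ z => unitsField (toUField U₀) ⟨z, κ⟩) (fun κ z => pertVar U₀ W ⟨z, κ⟩) x) j k‖ ^ 2))) (cB := 28800 * (F.L : ℝ) ^ 4) (cB' := 600000 * (F.L : ℝ) ^ 4)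
    (by linarith) hq hqL (by positivity) hM₀ hKD (by positivity) (by positivity) (K - n)
    (fun l => ∑ x : Site (F.P K) l, ‖((frameAccU l (unitsField (toUField U₀)) (unitsField (toUField W)) x : (Matrix (Fin 2) (Fin 2) ℂ)ˣ) : Matrix (Fin 2) (Fin 2) ℂ) - 1‖ ^ 2)
    (fun l => ∑ b : PBond (F.P K) l, ‖(pertVar (Averaging.iter (fun i => blockAvg (P := (F.P K)) (j := i) (expMeanLogSU (n := Fin 2))) l U₀) (Averaging.iter (fun i => blockAvg (P := (F.P K)) (j := i) (expMeanLogSU (n := Fin 2))) l W)) b‖ ^ 2)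
    (fun l => ∑ b : PBond (F.P K) l, ‖((dbarCovIterU l (unitsField (toUField U₀)) (unitsField (toUField W)) b * (emlIterU l (unitsField (toUField U₀)) b)⁻¹ : (Matrix (Fin 2) (Fin 2) ℂ)ˣ) : Matrix (Fin 2) (Fin 2) ℂ) - 1‖ ^ 2)
    hΦ0 hΦ (fun l hl => by have := hM l hl; linarith) hMtw l hl
  have e1 : (21 + 252 * (F.L : ℝ) * (40 * (F.L : ℝ) ^ 2)) = 21 + 10080 * (F.L : ℝ) ^ 3 := by ring
  have e2 : (3 + 18 * (40 * (F.L : ℝ) ^ 2)) = 3 + 720 * (F.L : ℝ) ^ 2 := by ring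
  rw [e1, e2] at h
  exact h

/-- ★★★ **THE TWISTED LEVEL MASSES AT T³ UNDER (n3)'S BINDERS ALONE** (d = 3, `SU(2)`): the hypotheses are ✓ `Prop7FibreLevelMassPerLevelT3.sum_normSq_levelRatio_le_LOnly_T3`'s
`hε hεL hU μ hμ0 hμ hμ72 hμN hθ0 hμθ hθL` VERBATIM and nothing else — both (0.4) guards are DISCHARGED by px22 g4's ✓ `Prop7CompetitorGuardOfLevelSups.small_iter_background_T3'` ∕
`small_iter_competitor_T3`; for every `l ≤ K − n`:
`Σ_b ‖V^{(l)}(b)·Ū₀^{(l)}(b)⁻¹ − 1‖² ≤ (21 + 10080L³)·M₀·(Lˡ)⁻¹ + (3 + 720L²)·(28800L⁴·(CURL + DIV) + 600000L⁴·ℓ⁻²·M₀)·Lˡ` — the `hM` shape of ✓ `Prop7JointRowOfLevelMasses.jointRow_currency`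
(`c_A = 21 + 10080L³`, `c_B = (3 + 720L²)·28800L⁴`, `c_B′·ε ↦ (3 + 720L²)·600000L⁴`) for the TWISTED tower `V^{(l)} = dbarCovIterU l U₀♭ W♭` against `Ū₀^{(l)} = emlIterU l U₀♭`.
[cite: Balaban1985Averaging, (89) p.31, (97) p.32, Prop. 3 (122)-(126) p.36; Balaban1984PropagatorsI, (1.18)-(1.20) pp.19-20; Balaban1985Variational, (14)-(15) p.280, Prop. 7 p.299] -/
theorem sum_normSq_twistedLevelRatio_le_LOnly_T3 (U₀ W : GaugeField (F.P K) 0 (Matrix.specialUnitaryGroup (Fin 2) ℂ)) {ε : ℝ} (hε : 0 < ε) (hεL : 1000000 * (F.L : ℝ) ^ 5 * ε ≤ 1)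
    (hU : ∀ p : Plaq (F.P K) 0, dist1 (GaugeField.plaqHol U₀ p) ≤ ε * (((F.L : ℝ) ^ (K - n)) ^ 2)⁻¹)
    (μ : ℕ → ℝ) (hμ0 : ∀ j < K - n, 0 ≤ μ j)
    (hμ : ∀ j < K - n, ∀ c : PBond (F.P K) (j + 1), ((((F.P K).d + 2) * (F.P K).L : ℕ) : ℝ) * ∑ b ∈ (univ.filter (fun b : PBond (F.P K) j => blockOf b.src = c.src ∨ blockOf b.src = c.tgt)), ‖(pertVar (Averaging.iter (fun i => blockAvg (P := (F.P K)) (j := i) (expMeanLogSU (n := Fin 2))) j U₀) (Averaging.iter (fun i => blockAvg (P := (F.P K)) (j := i) (expMeanLogSU (n := Fin 2))) j W)) b‖ ≤ μ j)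
    (hμ72 : ∀ j < K - n, 72 * μ j ≤ 1) (hμN : ∀ j < K - n, 3 * μ j + 1 / 24 < deltaSU (Fin 2))
    {θ : ℝ} (hθ0 : 0 ≤ θ) (hμθ : ∀ j < K - n, 7800 * (F.L : ℝ) ^ 3 * (F.L : ℝ) ^ (K - n) * μ j ≤ θ * (F.L : ℝ) ^ j)
    (hθL : 1000 * θ * (F.L : ℝ) ≤ 1) :
    ∀ l ≤ K - n, ∑ b : PBond (F.P K) l, ‖((dbarCovIterU l (unitsField (toUField U₀)) (unitsField (toUField W)) b * (emlIterU l (unitsField (toUField U₀)) b)⁻¹ : (Matrix (Fin 2) (Fin 2) ℂ)ˣ) : Matrix (Fin 2) (Fin 2) ℂ) - 1‖ ^ 2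
      ≤ (21 + 10080 * (F.L : ℝ) ^ 3) * ((∑ b : PBond (F.P K) 0, ‖pertVar U₀ W b‖ ^ 2) * ((F.L : ℝ) ^ l)⁻¹)
        + (3 + 720 * (F.L : ℝ) ^ 2) * ((28800 * (F.L : ℝ) ^ 4 * ((∑ x : Site (F.P K) 0, ∑ μ : Fin (F.P K).d, ∑ ν : Fin (F.P K).d,
            (if μ < ν then ∑ j : Fin 2, ∑ k : Fin 2,
              ‖(curl (torusT (F.P K) 0) (fun κ z => unitsField (toUField U₀) ⟨z, κ⟩) (fun κ z => pertVar U₀ W ⟨z, κ⟩) μ ν x) j k‖ ^ 2 else 0)) + (∑ x : Site (F.P K) 0, ∑ j : Fin 2, ∑ k : Fin 2,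
            ‖(divB (torusT (F.P K) 0) (fun κ z => unitsField (toUField U₀) ⟨z, κ⟩) (fun κ z => pertVar U₀ W ⟨z, κ⟩) x) j k‖ ^ 2))
            + 600000 * (F.L : ℝ) ^ 4 * (((F.L : ℝ) ^ (K - n)) ^ 2)⁻¹ * (∑ b : PBond (F.P K) 0, ‖pertVar U₀ W b‖ ^ 2)) * (F.L : ℝ) ^ l) :=
  sum_normSq_twistedLevelRatio_le_LOnly_T3_of_guards F n K U₀ W hε hεL hU
    (small_iter_background_T3' F n K U₀ hε hεL hU) (small_iter_competitor_T3 F n K U₀ W hε hεL hU μ hμ0 hμ hμ72 hμN)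
    μ hμ0 hμ hμ72 hμN hθ0 hμθ hθL

/-- ★★ **THE TWISTED LINK IN SUP** (guards displayed): for every `l ≤ K − n` and every level-`l` bond, `‖V^{(l)}(b)·Ū₀^{(l)}(b)⁻¹ − 1‖ ≤ 4ρ_l + ‖Y_l(b)‖` (F3″-C1 ✓ `norm_twistedLink_sub_one_le`
with §3's frame sup `2ρ_l` at both ends; `Y_l = pertVar Ū₀^{(l)} W̄^{(l)}`) — the sup letter a log-currency consumer needs (`‖mlog X‖ ≤ 2‖X − 1‖` under `‖X − 1‖ ≤ ½`, lit ✓ `MatrixLog.norm_mlog_le_two_mul`).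
[cite: Balaban1985Averaging, (89) p.31, (97) p.32] -/
theorem norm_twistedLevelRatio_sub_one_le_of_guards (U₀ W : GaugeField (F.P K) 0 (Matrix.specialUnitaryGroup (Fin 2) ℂ))
    (hU₀g : ∀ i, i < K - n → ∀ c : PBond (F.P K) (i + 1), Small (expMeanLogSU (n := Fin 2)) (Averaging.iter (fun j => blockAvg (P := F.P K) (j := j) (expMeanLogSU (n := Fin 2))) i U₀) c)
    (hWg : ∀ i, i < K - n → ∀ c : PBond (F.P K) (i + 1), Small (expMeanLogSU (n := Fin 2)) (Averaging.iter (fun j => blockAvg (P := F.P K) (j := j) (expMeanLogSU (n := Fin 2))) i W) c)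
    (μ : ℕ → ℝ)
    (hμ : ∀ j < K - n, ∀ c : PBond (F.P K) (j + 1), ((((F.P K).d + 2) * (F.P K).L : ℕ) : ℝ) * ∑ b ∈ (univ.filter (fun b : PBond (F.P K) j => blockOf b.src = c.src ∨ blockOf b.src = c.tgt)), ‖(pertVar (Averaging.iter (fun i => blockAvg (P := (F.P K)) (j := i) (expMeanLogSU (n := Fin 2))) j U₀) (Averaging.iter (fun i => blockAvg (P := (F.P K)) (j := i) (expMeanLogSU (n := Fin 2))) j W)) b‖ ≤ μ j)
    (hμ72 : ∀ j < K - n, 72 * μ j ≤ 1)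
    {θ : ℝ} (hθ0 : 0 ≤ θ) (hμθ : ∀ j < K - n, 7800 * (F.L : ℝ) ^ 3 * (F.L : ℝ) ^ (K - n) * μ j ≤ θ * (F.L : ℝ) ^ j)
    (hθL : 1000 * θ * (F.L : ℝ) ≤ 1) :
    ∀ l, l ≤ K - n → ∀ b : PBond (F.P K) l,
      ‖((dbarCovIterU l (unitsField (toUField U₀)) (unitsField (toUField W)) b * (emlIterU l (unitsField (toUField U₀)) b)⁻¹ : (Matrix (Fin 2) (Fin 2) ℂ)ˣ) : Matrix (Fin 2) (Fin 2) ℂ) - 1‖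
        ≤ 4 * (θ * (F.L : ℝ) ^ l / (7800 * (F.L : ℝ) ^ 3 * (F.L : ℝ) ^ (K - n))) + ‖(pertVar (Averaging.iter (fun i => blockAvg (P := (F.P K)) (j := i) (expMeanLogSU (n := Fin 2))) l U₀) (Averaging.iter (fun i => blockAvg (P := (F.P K)) (j := i) (expMeanLogSU (n := Fin 2))) l W)) b‖ := by
  intro l hl b
  obtain ⟨hsu, hsup⟩ := frameAccU_su2_and_sup F n K U₀ W hU₀g hWg μ hμ hμ72 hθ0 hμθ hθL l hl
  have hUeq := emlIterU_eq_unitsField_iter U₀ (K - n) hU₀g hl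
  have hWeq := emlIterU_eq_unitsField_iter W (K - n) hWg hl
  have h := Prop7TwistedLinkFrameSup.norm_twistedLink_sub_one_le l (unitsField (toUField U₀)) (unitsField (toUField W)) b
    (norm_le_one_of_mem_specialUnitaryGroup (hsu _)).2 (norm_le_one_of_mem_specialUnitaryGroup (hsu _)).1
    (by rw [hWeq]; exact (norm_le_one_of_mem_specialUnitaryGroup (coe_unitsField_mem_su2 _ b)).1)
    (by rw [hUeq]; exact (norm_le_one_of_mem_specialUnitaryGroup (coe_unitsField_mem_su2 _ b)).1)
    (by rw [hUeq]; exact (norm_le_one_of_mem_specialUnitaryGroup (coe_unitsField_mem_su2 _ b)).2)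
  have hY : ‖((emlIterU l (unitsField (toUField W)) b * (emlIterU l (unitsField (toUField U₀)) b)⁻¹ : (Matrix (Fin 2) (Fin 2) ℂ)ˣ) : Matrix (Fin 2) (Fin 2) ℂ) - 1‖ = ‖(pertVar (Averaging.iter (fun i => blockAvg (P := (F.P K)) (j := i) (expMeanLogSU (n := Fin 2))) l U₀) (Averaging.iter (fun i => blockAvg (P := (F.P K)) (j := i) (expMeanLogSU (n := Fin 2))) l W)) b‖ := by
    rw [hUeq, hWeq, coe_unitsField_mul_inv_sub_one]
  linarith [hsup b.src, hsup b.tgt]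

/-- the log currency from the `‖· − 1‖` currency: if every `‖x_b − 1‖ ≤ ½` then `Σ_b ‖log x_b‖² ≤ 4·Σ_b ‖x_b − 1‖²` (lit ✓ `MatrixLog.norm_mlog_le_two_mul`). [folklore] -/
theorem sum_normSq_mlog_le_four_mul {ι : Type*} (s : Finset ι) (x : ι → Matrix (Fin 2) (Fin 2) ℂ) (hx : ∀ b ∈ s, ‖x b - 1‖ ≤ 1 / 2) :
    ∑ b ∈ s, ‖MatrixLog.mlog (x b)‖ ^ 2 ≤ 4 * ∑ b ∈ s, ‖x b - 1‖ ^ 2 := by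
  rw [Finset.mul_sum]
  refine Finset.sum_le_sum fun b hb => ?_
  have h := MatrixLog.norm_mlog_le_two_mul (hx b hb)
  have h0 : 0 ≤ ‖MatrixLog.mlog (x b)‖ := norm_nonneg _
  nlinarith

/-- ★★★ **THE TWISTED LEVEL MASSES IN LOG CURRENCY, BELOW THE TOP, UNDER (n3)'S BINDERS ALONE**: for every `l < K − n` (the levels the F0″ telescope sums over), the level-`l`
log-field `A_l(b) = log(V^{(l)}(b)·Ū₀^{(l)}(b)⁻¹)` of the covariant one-step chart (F1″-COV's input: the level-`l` field is `e^{A_l}·Ū₀^{(l)}`) has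
`Σ_b ‖A_l(b)‖² ≤ 4·[(21 + 10080L³)·M₀·(Lˡ)⁻¹ + (3 + 720L²)·(28800L⁴·(CURL + DIV) + 600000L⁴·ℓ⁻²·M₀)·Lˡ]` — the sup needed for `‖log x‖ ≤ 2‖x − 1‖` is `4ρ_l + μ_l∕(5L) ≤ ½` from §5's sup
letter and (n3)'s `hμ` (guards discharged by ✓p692191). [cite: Balaban1985Averaging, (89) p.31, (97) p.32, Prop. 3 (122)-(126) p.36; Balaban1984PropagatorsI, (1.18)-(1.20) pp.19-20; Balaban1985Variational, (15) p.280, Prop. 7 p.299] -/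
theorem sum_normSq_mlog_twistedLevelRatio_le_LOnly_T3 (U₀ W : GaugeField (F.P K) 0 (Matrix.specialUnitaryGroup (Fin 2) ℂ)) {ε : ℝ} (hε : 0 < ε) (hεL : 1000000 * (F.L : ℝ) ^ 5 * ε ≤ 1)
    (hU : ∀ p : Plaq (F.P K) 0, dist1 (GaugeField.plaqHol U₀ p) ≤ ε * (((F.L : ℝ) ^ (K - n)) ^ 2)⁻¹)
    (μ : ℕ → ℝ) (hμ0 : ∀ j < K - n, 0 ≤ μ j)
    (hμ : ∀ j < K - n, ∀ c : PBond (F.P K) (j + 1), ((((F.P K).d + 2) * (F.P K).L : ℕ) : ℝ) * ∑ b ∈ (univ.filter (fun b : PBond (F.P K) j => blockOf b.src = c.src ∨ blockOf b.src = c.tgt)), ‖(pertVar (Averaging.iter (fun i => blockAvg (P := (F.P K)) (j := i) (expMeanLogSU (n := Fin 2))) j U₀) (Averaging.iter (fun i => blockAvg (P := (F.P K)) (j := i) (expMeanLogSU (n := Fin 2))) j W)) b‖ ≤ μ j)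
    (hμ72 : ∀ j < K - n, 72 * μ j ≤ 1) (hμN : ∀ j < K - n, 3 * μ j + 1 / 24 < deltaSU (Fin 2))
    {θ : ℝ} (hθ0 : 0 ≤ θ) (hμθ : ∀ j < K - n, 7800 * (F.L : ℝ) ^ 3 * (F.L : ℝ) ^ (K - n) * μ j ≤ θ * (F.L : ℝ) ^ j)
    (hθL : 1000 * θ * (F.L : ℝ) ≤ 1) :
    ∀ l, l < K - n → ∑ b : PBond (F.P K) l, ‖MatrixLog.mlog (((dbarCovIterU l (unitsField (toUField U₀)) (unitsField (toUField W)) b * (emlIterU l (unitsField (toUField U₀)) b)⁻¹ : (Matrix (Fin 2) (Fin 2) ℂ)ˣ) : Matrix (Fin 2) (Fin 2) ℂ))‖ ^ 2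
      ≤ 4 * ((21 + 10080 * (F.L : ℝ) ^ 3) * ((∑ b : PBond (F.P K) 0, ‖pertVar U₀ W b‖ ^ 2) * ((F.L : ℝ) ^ l)⁻¹)
        + (3 + 720 * (F.L : ℝ) ^ 2) * ((28800 * (F.L : ℝ) ^ 4 * ((∑ x : Site (F.P K) 0, ∑ μ : Fin (F.P K).d, ∑ ν : Fin (F.P K).d,
            (if μ < ν then ∑ j : Fin 2, ∑ k : Fin 2,
              ‖(curl (torusT (F.P K) 0) (fun κ z => unitsField (toUField U₀) ⟨z, κ⟩) (fun κ z => pertVar U₀ W ⟨z, κ⟩) μ ν x) j k‖ ^ 2 else 0)) + (∑ x : Site (F.P K) 0, ∑ j : Fin 2, ∑ k : Fin 2,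
            ‖(divB (torusT (F.P K) 0) (fun κ z => unitsField (toUField U₀) ⟨z, κ⟩) (fun κ z => pertVar U₀ W ⟨z, κ⟩) x) j k‖ ^ 2))
            + 600000 * (F.L : ℝ) ^ 4 * (((F.L : ℝ) ^ (K - n)) ^ 2)⁻¹ * (∑ b : PBond (F.P K) 0, ‖pertVar U₀ W b‖ ^ 2)) * (F.L : ℝ) ^ l)) := by
  intro l hl'
  have hL3 : (3 : ℝ) ≤ F.L := Prop7CurvedLandauKnitT3.three_le_L F
  have hL0 : (0 : ℝ) < F.L := by linarith
  have hd : (F.P K).d = 3 := T3Family.P_d F K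
  have hlK : l + 1 ≤ (F.P K).m + (F.P K).K := by show l + 1 ≤ F.m + K; have := F.hm; omega
  have hU₀g := small_iter_background_T3' F n K U₀ hε hεL hU
  have hWg := small_iter_competitor_T3 F n K U₀ W hε hεL hU μ hμ0 hμ hμ72 hμN
  have hmass := sum_normSq_twistedLevelRatio_le_LOnly_T3 F n K U₀ W hε hεL hU μ hμ0 hμ hμ72 hμN hθ0 hμθ hθL l hl'.le
  have hsupρ := norm_twistedLevelRatio_sub_one_le_of_guards F n K U₀ W hU₀g hWg μ hμ hμ72 hθ0 hμθ hθL l hl'.le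
  -- the single-bar sup below the top: `‖Y_l b‖ ≤ 3L√B ≤ μ_l ≤ 1∕72` would do; sharper: `‖Y_l b‖ ≤ μ_l` via the stair row's block bound
  obtain ⟨-, hstairμ⟩ := stair_row_of_twoBlockSup hd hlK (Averaging.iter (fun i => blockAvg (P := (F.P K)) (j := i) (expMeanLogSU (n := Fin 2))) l U₀) (Averaging.iter (fun i => blockAvg (P := (F.P K)) (j := i) (expMeanLogSU (n := Fin 2))) l W) (hμ l hl') (hμ72 l hl')
  obtain ⟨hρ0, -, hρ6, -⟩ := rho_facts hL3 hθ0 hθL (K - n) l hl'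
  have hY : ∀ b : PBond (F.P K) l, ‖(pertVar (Averaging.iter (fun i => blockAvg (P := (F.P K)) (j := i) (expMeanLogSU (n := Fin 2))) l U₀) (Averaging.iter (fun i => blockAvg (P := (F.P K)) (j := i) (expMeanLogSU (n := Fin 2))) l W)) b‖ ≤ μ l := by
    intro b
    have h1 : ‖(pertVar (Averaging.iter (fun i => blockAvg (P := (F.P K)) (j := i) (expMeanLogSU (n := Fin 2))) l U₀) (Averaging.iter (fun i => blockAvg (P := (F.P K)) (j := i) (expMeanLogSU (n := Fin 2))) l W)) b‖ ≤ Real.sqrt (∑ b' ∈ univ.filter (fun b' : PBond (F.P K) l => blockOf b'.src = blockOf b.src), ‖(pertVar (Averaging.iter (fun i => blockAvg (P := (F.P K)) (j := i) (expMeanLogSU (n := Fin 2))) l U₀) (Averaging.iter (fun i => blockAvg (P := (F.P K)) (j := i) (expMeanLogSU (n := Fin 2))) l W)) b'‖ ^ 2) := by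
      have hmem : b ∈ univ.filter (fun b' : PBond (F.P K) l => blockOf b'.src = blockOf b.src) := by
        rw [Finset.mem_filter]; exact ⟨Finset.mem_univ b, rfl⟩
      rw [← Real.sqrt_sq (norm_nonneg ((pertVar (Averaging.iter (fun i => blockAvg (P := (F.P K)) (j := i) (expMeanLogSU (n := Fin 2))) l U₀) (Averaging.iter (fun i => blockAvg (P := (F.P K)) (j := i) (expMeanLogSU (n := Fin 2))) l W)) b))]
      exact Real.sqrt_le_sqrt (Finset.single_le_sum (f := fun b' => ‖(pertVar (Averaging.iter (fun i => blockAvg (P := (F.P K)) (j := i) (expMeanLogSU (n := Fin 2))) l U₀) (Averaging.iter (fun i => blockAvg (P := (F.P K)) (j := i) (expMeanLogSU (n := Fin 2))) l W)) b'‖ ^ 2) (fun _ _ => sq_nonneg _) hmem)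
    have h3 : Real.sqrt (∑ b' ∈ univ.filter (fun b' : PBond (F.P K) l => blockOf b'.src = blockOf b.src), ‖(pertVar (Averaging.iter (fun i => blockAvg (P := (F.P K)) (j := i) (expMeanLogSU (n := Fin 2))) l U₀) (Averaging.iter (fun i => blockAvg (P := (F.P K)) (j := i) (expMeanLogSU (n := Fin 2))) l W)) b'‖ ^ 2)
        ≤ 3 * (F.L : ℝ) * Real.sqrt (∑ b' ∈ univ.filter (fun b' : PBond (F.P K) l => blockOf b'.src = blockOf b.src), ‖(pertVar (Averaging.iter (fun i => blockAvg (P := (F.P K)) (j := i) (expMeanLogSU (n := Fin 2))) l U₀) (Averaging.iter (fun i => blockAvg (P := (F.P K)) (j := i) (expMeanLogSU (n := Fin 2))) l W)) b'‖ ^ 2) :=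
      le_mul_of_one_le_left (Real.sqrt_nonneg _) (by linarith)
    exact h1.trans (h3.trans (hstairμ (blockOf b.src)))
  have hsup : ∀ b ∈ (univ : Finset (PBond (F.P K) l)),
      ‖((dbarCovIterU l (unitsField (toUField U₀)) (unitsField (toUField W)) b * (emlIterU l (unitsField (toUField U₀)) b)⁻¹ : (Matrix (Fin 2) (Fin 2) ℂ)ˣ) : Matrix (Fin 2) (Fin 2) ℂ) - 1‖ ≤ 1 / 2 := by
    intro b _
    have h72 := hμ72 l hl'
    have h1 := hsupρ b
    have h2 := hY b
    linarith
  exact (sum_normSq_mlog_le_four_mul univ _ hsup).trans (mul_le_mul_of_nonneg_left hmass (by norm_num))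

/-- ★★★ **THE SAME IN THE `hM` SHAPE OF ✓ `Prop7JointRowOfLevelMasses.jointRow_currency` ∕ ✓ `…Q.jointRow_currency_q`** (`M l ≤ cA·M₀·(Lˡ)⁻¹ + (cB·KD + cB′·ε·((L^k)²)⁻¹·M₀)·Lˡ` for `l < k`),
with `k = K − n`, `M l = Σ_b‖mlog(V^{(l)}(b)Ū₀^{(l)}(b)⁻¹)‖²`, `cA = 4(21 + 10080L³)`, `cB = 4(3 + 720L²)·28800L⁴`, `cB′ = 4(3 + 720L²)·600000L⁴`, `ε = 1`, `KD = CURL + DIV`, `M₀ = Σ‖pertVar U₀ W‖²`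
— so the F4″ assembler feeds it by `exact`. [cite: Balaban1985Averaging, Prop. 3 (122)-(126) p.36; Balaban1984PropagatorsI, (1.18)-(1.20) pp.19-20; Balaban1985Variational, Prop. 7 p.299] -/
theorem twistedLevelMass_hM_log_T3 (U₀ W : GaugeField (F.P K) 0 (Matrix.specialUnitaryGroup (Fin 2) ℂ)) {ε : ℝ} (hε : 0 < ε) (hεL : 1000000 * (F.L : ℝ) ^ 5 * ε ≤ 1)
    (hU : ∀ p : Plaq (F.P K) 0, dist1 (GaugeField.plaqHol U₀ p) ≤ ε * (((F.L : ℝ) ^ (K - n)) ^ 2)⁻¹)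
    (μ : ℕ → ℝ) (hμ0 : ∀ j < K - n, 0 ≤ μ j)
    (hμ : ∀ j < K - n, ∀ c : PBond (F.P K) (j + 1), ((((F.P K).d + 2) * (F.P K).L : ℕ) : ℝ) * ∑ b ∈ (univ.filter (fun b : PBond (F.P K) j => blockOf b.src = c.src ∨ blockOf b.src = c.tgt)), ‖(pertVar (Averaging.iter (fun i => blockAvg (P := (F.P K)) (j := i) (expMeanLogSU (n := Fin 2))) j U₀) (Averaging.iter (fun i => blockAvg (P := (F.P K)) (j := i) (expMeanLogSU (n := Fin 2))) j W)) b‖ ≤ μ j)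
    (hμ72 : ∀ j < K - n, 72 * μ j ≤ 1) (hμN : ∀ j < K - n, 3 * μ j + 1 / 24 < deltaSU (Fin 2))
    {θ : ℝ} (hθ0 : 0 ≤ θ) (hμθ : ∀ j < K - n, 7800 * (F.L : ℝ) ^ 3 * (F.L : ℝ) ^ (K - n) * μ j ≤ θ * (F.L : ℝ) ^ j)
    (hθL : 1000 * θ * (F.L : ℝ) ≤ 1) :
    ∀ l < K - n, ∑ b : PBond (F.P K) l, ‖MatrixLog.mlog (((dbarCovIterU l (unitsField (toUField U₀)) (unitsField (toUField W)) b * (emlIterU l (unitsField (toUField U₀)) b)⁻¹ : (Matrix (Fin 2) (Fin 2) ℂ)ˣ) : Matrix (Fin 2) (Fin 2) ℂ))‖ ^ 2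
      ≤ (4 * (21 + 10080 * (F.L : ℝ) ^ 3)) * (∑ b : PBond (F.P K) 0, ‖pertVar U₀ W b‖ ^ 2) * ((F.L : ℝ) ^ l)⁻¹
        + ((4 * (3 + 720 * (F.L : ℝ) ^ 2) * (28800 * (F.L : ℝ) ^ 4)) * ((∑ x : Site (F.P K) 0, ∑ μ : Fin (F.P K).d, ∑ ν : Fin (F.P K).d,
            (if μ < ν then ∑ j : Fin 2, ∑ k : Fin 2,
              ‖(curl (torusT (F.P K) 0) (fun κ z => unitsField (toUField U₀) ⟨z, κ⟩) (fun κ z => pertVar U₀ W ⟨z, κ⟩) μ ν x) j k‖ ^ 2 else 0)) + (∑ x : Site (F.P K) 0, ∑ j : Fin 2, ∑ k : Fin 2,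
            ‖(divB (torusT (F.P K) 0) (fun κ z => unitsField (toUField U₀) ⟨z, κ⟩) (fun κ z => pertVar U₀ W ⟨z, κ⟩) x) j k‖ ^ 2))
            + (4 * (3 + 720 * (F.L : ℝ) ^ 2) * (600000 * (F.L : ℝ) ^ 4)) * 1 * (((F.L : ℝ) ^ (K - n)) ^ 2)⁻¹ * (∑ b : PBond (F.P K) 0, ‖pertVar U₀ W b‖ ^ 2)) * (F.L : ℝ) ^ l := by
  intro l hl'
  have h := sum_normSq_mlog_twistedLevelRatio_le_LOnly_T3 F n K U₀ W hε hεL hU μ hμ0 hμ hμ72 hμN hθ0 hμθ hθL l hl'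
  refine h.trans (le_of_eq ?_)
  ring

end T3

end Summit.QuantumFields.YangMills.Theorems.Prop7TwistedLevelMassT3

end
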